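import Literature.MathematicalPhysics.QuantumLattice.HubbardTorusMarkovPressureClusterBound
import HarnessLib

/-!
# Weighted-cluster energy representatives of the `t–t'` Hubbard torus Hamiltonian (diagonal bonds):
# the energy identity for translation-invariant states on windows containing a `2 × 2` corner block

Topic `MathematicalPhysics/QuantumLattice`, namespace `Literature.MathematicalPhysics.QuantumLattice`.

`HubbardTorusClusterEnergyRepresentative.lean` represents the energy of the PURE Hubbard torus (`t' = 0`) in a
translation-invariant state by a weighted open cluster (bond weights summing to `1` per direction). This file
adds the next-nearest-neighbour (DIAGONAL) hopping of the `t–t'` model on the square torus `(ℤ/Lℤ)²`, `L ≥ 3`: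

* §1 `torusDiagBondKinetic w s` = `Σ_σ (c†_w c_{w+j_s} + h.c.)` for the two diagonal jumps
  `j_0 = e₀ + e₁`, `j_1 = e₀ − e₁` (`torusDiagJump`), and the bond decomposition
  `hamiltonian (fermionTorusDiagGraph L) t' 0 = −t' Σ_s Σ_w K^{diag}_{w,s}` (`diagHamiltonian_eq_kinetic_bond_sum`);
* §2 window diagonal bonds `clusterDiagKinetic Λ y s` (the bond `{x, x + diagVec s}` when both ends are in
  `Λ`), weights `diagBondWeight(Sum)`, the weighted diagonal cluster term `clusterDiagTerm Λ t' J'` and its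
  torus translates: `Σ_v T_v Γ(ι)(clusterDiagTerm) = −t' Σ_s (Σ_x J̃'(x,s)) Σ_w K^{diag}_{w,s}`;
* §3 the `t–t'` weighted cluster `clusterHamiltonianTT' Λ t t' U J J' V μ'` = `clusterHamiltonian + clusterDiagTerm`
  and, for NORMALISED weights (`Σ J̃(·,i) = 1`, `Σ J̃'(·,s) = 1`, `Σ V = 1`, `Σ μ' = −μ`),
  `Σ_v T_v Γ(ι) h T_v⁻¹ = H^{tt'}_L − μ N_L` and the ENERGY IDENTITY
  `tr(ρ (H^{tt'}_L − μN)) = L² · tr(ρ_Λ h)` for translation-invariant `ρ` (`trace_mul_hubbardTorusTT'_sub_eq_cluster`);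
* §4 CORNER weights for the diagonal bonds (`cornerDiagBondWeight a`: the bonds `(a − e₀ − e₁, a)` and
  `(a − e₀, a − e₁)` of the `2 × 2` corner block) and the `t–t'` corner representative `cornerEnergyRepTT'`
  `= U n_{a↑}n_{a↓} − μ n_a − t (hop(a−e₀,a) + hop(a−e₁,a)) − t' (hop(a−e₀−e₁,a) + hop(a−e₀,a−e₁))`, with its
  normalisation lemmas — so the programme's 2-row shields qualify at `t' ≠ 0` (the cuprate box).

[cite: XuEtAl2024, eq. (1)] (the `t–t'–U` torus Hamiltonian); [cite: Anderson1951, eq. (2)] (cluster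
bookkeeping); [cite: BratteliRobinsonII1997, §6.2.4]. Everything is PROVED; the definitions are concrete
bookkeeping (bond operators and weights); no named fact. Consumer: `HubbardTorusTTPrimeMarkovPressureClusterBound.lean`.
-/

noncomputable section

namespace Literature.MathematicalPhysics.QuantumLattice

open Matrix Finset HubbardWave0 Literature.Probability.LatticeModels AndersonCluster
open scoped ComplexOrder

/-! ### §1. Diagonal bond operators on the torus; the diagonal hopping Hamiltonian as a bond sum -/

section Torus

variable {L : ℕ} [NeZero L]

/-- (Local to this file, as in `HubbardAndersonClusterBound.lean`.) Equality of torus sites is decided through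
the linear order — the instance the generic Jordan–Wigner lemmas carry. [folklore] -/
local instance (priority := high) instDecidableEqFermionTorusTTCluster : DecidableEq (FermionTorus 2 L) :=
  LinearOrder.toDecidableEq

/-- The symmetric hopping term `Σ_σ (c†_{wσ} c_{w+j_s,σ} + c†_{w+j_s,σ} c_{wσ})` of the DIAGONAL torus bond
`{w, w + j_s}` (`j_0 = e₀ + e₁`, `j_1 = e₀ − e₁`). [cite: XuEtAl2024, eq. (1)] -/
def torusDiagBondKinetic (w : TorusSite 2 L) (s : Fin 2) :
    Matrix (Finset (Orb (FermionTorus 2 L))) (Finset (Orb (FermionTorus 2 L))) ℂ :=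
  ∑ σ : Fin 2,
    (creation (orb (FermionTorus.ofTorusSite w) σ) *
        annihilation (orb (FermionTorus.ofTorusSite (w + torusDiagJump L s)) σ) +
      creation (orb (FermionTorus.ofTorusSite (w + torusDiagJump L s)) σ) *
        annihilation (orb (FermionTorus.ofTorusSite w) σ))

/-- `T_v K^{diag}_{w,s} T_v⁻¹ = K^{diag}_{w+v,s}`. [cite: XuEtAl2024, eq. (1)] -/
theorem relabel_translate_torusDiagBondKinetic (v w : TorusSite 2 L) (s : Fin 2) :
    relabel (Orb.translate v) (torusDiagBondKinetic w s) = torusDiagBondKinetic (w + v) s := by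
  rw [torusDiagBondKinetic, torusDiagBondKinetic, relabel_sum]
  refine Finset.sum_congr rfl fun σ _ => ?_
  rw [relabel_add, relabel_mul, relabel_mul, relabel_translate_creation, relabel_translate_annihilation,
    relabel_translate_creation, relabel_translate_annihilation, add_right_comm w (torusDiagJump L s) v]

/-- **The diagonal hopping Hamiltonian of the torus as a sum over diagonal bonds**, `L ≥ 3`:
`hamiltonian (fermionTorusDiagGraph L) t' 0 = −t' Σ_s Σ_w K^{diag}_{w,s}`. [cite: XuEtAl2024, eq. (1)] -/
theorem diagHamiltonian_eq_kinetic_bond_sum (t' : ℝ) (hL : 3 ≤ L) :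
    hamiltonian (fermionTorusDiagGraph L) t' 0 =
      -(t' : ℂ) • ∑ s : Fin 2, ∑ w : TorusSite 2 L, torusDiagBondKinetic w s := by
  set o : TorusSite 2 L → FermionTorus 2 L := FermionTorus.ofTorusSite with ho
  rw [hamiltonian, Complex.ofReal_zero, zero_smul, add_zero]
  congr 1
  -- rewrite the site sums over `TorusSite 2 L`
  rw [← Fintype.sum_equiv FermionTorus.equivTorusSite.symm
    (fun v : TorusSite 2 L => ∑ s : Fin 2, ∑ σ : Fin 2,
      (creation (orb (o v) σ) * annihilation (orb (o (v + torusDiagJump L s)) σ) +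
        creation (orb (o v) σ) * annihilation (orb (o (v - torusDiagJump L s)) σ))) _ (fun v => ?_)]
  · -- `Σ_v Σ_s (fwd + bwd) = Σ_s Σ_w K_{w,s}` by shifting the backward half
    rw [Finset.sum_comm]
    refine Finset.sum_congr rfl fun s _ => ?_
    simp only [Finset.sum_add_distrib]
    have hshift : ∑ v : TorusSite 2 L, ∑ σ : Fin 2,
        creation (orb (o v) σ) * annihilation (orb (o (v - torusDiagJump L s)) σ) =
        ∑ v : TorusSite 2 L, ∑ σ : Fin 2,
          creation (orb (o (v + torusDiagJump L s)) σ) * annihilation (orb (o v) σ) :=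
      TorusSite.sum_sub_shift (torusDiagJump L s)
        (fun a b => ∑ σ : Fin 2, creation (orb (o a) σ) * annihilation (orb (o b) σ))
    rw [hshift, ← Finset.sum_add_distrib]
    refine Finset.sum_congr rfl fun v _ => ?_
    rw [torusDiagBondKinetic, ← Finset.sum_add_distrib]
  · -- the neighbour sum at the site `v`
    rw [← Fintype.sum_equiv FermionTorus.equivTorusSite.symm
      (fun w : TorusSite 2 L => ∑ σ : Fin 2,
        if (fermionTorusDiagGraph L).Adj (FermionTorus.equivTorusSite.symm v) (o w) then
          creation (orb (FermionTorus.equivTorusSite.symm v) σ) * annihilation (orb (o w) σ) else 0)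
      _ (fun w => rfl)]
    have hv : (FermionTorus.equivTorusSite.symm v : FermionTorus 2 L) = o v := rfl
    simp_rw [hv]
    have hadj : ∀ w : TorusSite 2 L, (fermionTorusDiagGraph L).Adj (o v) (o w) ↔ (torusDiagGraph L).Adj v w := by
      intro w
      rw [fermionTorusDiagGraph_adj, ho, FermionTorus.toTorusSite_ofTorusSite, FermionTorus.toTorusSite_ofTorusSite]
    have hite : ∀ w : TorusSite 2 L, (∑ σ : Fin 2,
        if (fermionTorusDiagGraph L).Adj (o v) (o w) then creation (orb (o v) σ) * annihilation (orb (o w) σ)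
          else 0) =
        if (torusDiagGraph L).Adj v w then ∑ σ : Fin 2, creation (orb (o v) σ) * annihilation (orb (o w) σ)
          else 0 := by
      intro w
      by_cases h : (torusDiagGraph L).Adj v w
      · rw [if_pos h]
        exact Finset.sum_congr rfl fun σ _ => by rw [if_pos ((hadj _).2 h)]
      · rw [if_neg h]
        exact Finset.sum_eq_zero fun σ _ => by rw [if_neg (fun h' => h ((hadj _).1 h'))]
    simp_rw [hite]
    rw [sum_ite_torusDiagGraph_adj hL v]
    simp only [Finset.sum_add_distrib]

end Torus

/-! ### §2. Window diagonal bonds and their torus translates -/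

section Cluster

/-- The weight of the directed diagonal window bond `(x, x + diagVec s)` actually used: `J' x s` if the far
endpoint lies in the window, else `0`. [cite: Anderson1951, eq. (2)] -/
def diagBondWeight (Λ' : Finset (Site 2)) (J' : Site 2 → Fin 2 → ℝ) (x : Site 2) (s : Fin 2) : ℝ :=
  if x + diagVec s ∈ Λ' then J' x s else 0

/-- Total weight of the window's diagonal bonds of type `s`. [cite: Anderson1951, eq. (2)] -/
def diagBondWeightSum (Λ' : Finset (Site 2)) (J' : Site 2 → Fin 2 → ℝ) (s : Fin 2) : ℝ :=
  ∑ x ∈ Λ', diagBondWeight Λ' J' x s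

/-- The kinetic term `Σ_σ (c†_x c_{x+diagVec s} + h.c.) ∈ 𝔄_{Λ'}` of the diagonal window bond
`{x, x + diagVec s}` (`x = ofLex y.1`), and `0` when the far end is outside. [cite: XuEtAl2024, eq. (1)] -/
def clusterDiagKinetic (Λ' : Finset (Site 2)) (y : PolySite Λ') (s : Fin 2) : FermionOp Λ' :=
  if h : ofLex y.1 + diagVec s ∈ Λ' then
    ∑ σ : Fin 2,
      (creation (orb y σ) * annihilation (orb (PolySite.pt (ofLex y.1 + diagVec s) h) σ) +
        creation (orb (PolySite.pt (ofLex y.1 + diagVec s) h) σ) * annihilation (orb y σ))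
  else 0

/-- The weighted DIAGONAL cluster term `−t' Σ_{y,s} J'(y,s) · K^{diag}_{y,s} ∈ 𝔄_{Λ'}`. [cite: XuEtAl2024, eq. (1)] -/
def clusterDiagTerm (Λ' : Finset (Site 2)) (t' : ℝ) (J' : Site 2 → Fin 2 → ℝ) : FermionOp Λ' :=
  -(t' : ℂ) • ∑ y : PolySite Λ', ∑ s : Fin 2, ((J' (ofLex y.1) s : ℝ) : ℂ) • clusterDiagKinetic Λ' y s

/-- The diagonal window bond term is Hermitian. [cite: XuEtAl2024, eq. (1)] -/
theorem isHermitian_clusterDiagKinetic (Λ' : Finset (Site 2)) (y : PolySite Λ') (s : Fin 2) :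
    (clusterDiagKinetic Λ' y s).IsHermitian := by
  unfold clusterDiagKinetic
  split_ifs with h
  · unfold Matrix.IsHermitian
    rw [Matrix.conjTranspose_sum]
    refine Finset.sum_congr rfl fun σ _ => ?_
    have hX : creation (orb (PolySite.pt (ofLex y.1 + diagVec s) h) σ) * annihilation (orb y σ) =
        (creation (orb y σ) * annihilation (orb (PolySite.pt (ofLex y.1 + diagVec s) h) σ) : FermionOp Λ')ᴴ := by
      simp only [creation, Matrix.conjTranspose_mul, Matrix.conjTranspose_conjTranspose]
    rw [hX]
    exact (Matrix.isHermitian_add_transpose_self _).eq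
  · exact Matrix.isHermitian_zero

/-- The weighted diagonal cluster term is Hermitian. [cite: XuEtAl2024, eq. (1)] -/
theorem isHermitian_clusterDiagTerm (Λ' : Finset (Site 2)) (t' : ℝ) (J' : Site 2 → Fin 2 → ℝ) :
    (clusterDiagTerm Λ' t' J').IsHermitian := by
  unfold clusterDiagTerm
  rw [← Complex.ofReal_neg]
  refine isHermitian_real_smul ?_ _
  unfold Matrix.IsHermitian
  rw [Matrix.conjTranspose_sum]
  refine Finset.sum_congr rfl fun y _ => ?_
  rw [Matrix.conjTranspose_sum]
  refine Finset.sum_congr rfl fun s _ => ?_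
  exact (isHermitian_real_smul (isHermitian_clusterDiagKinetic Λ' y s) _).eq

variable {L : ℕ} [NeZero L]

/-- (Local, as in §1.) [folklore] -/
local instance (priority := high) instDecidableEqFermionTorusTTCluster' : DecidableEq (FermionTorus 2 L) :=
  LinearOrder.toDecidableEq

omit [NeZero L] in
/-- `Torus.proj` is additive (local copy). [cite: FriedliVelenik2017, §3.1] -/
private theorem proj_add_site' (x y : Site 2) : Torus.proj L (x + y) = Torus.proj L x + Torus.proj L y := by
  funext i; simp [Torus.proj]

/-- Sums over the ordered site set `PolySite Λ'` are sums over the region. [cite: Anderson1951, eq. (2)] -/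
private theorem PolySite.sum_ofLex_eq' {M : Type*} [AddCommMonoid M] (Λ' : Finset (Site 2)) (f : Site 2 → M) :
    ∑ y : PolySite Λ', f (ofLex y.1) = ∑ x ∈ Λ', f x := by
  conv_rhs => rw [← map_univ_polySiteEmb Λ', Finset.sum_map]
  rfl

/-- **The window diagonal bond in the torus**: `Γ(ι)` of the diagonal window bond term is the torus
diagonal bond term at `x mod L` (or `0`). [cite: XuEtAl2024, eq. (1)] -/
theorem fermionEmbed_toTorusEmb_clusterDiagKinetic {Λ' : Finset (Site 2)}
    (hT : Set.InjOn (Torus.proj (d := 2) L) ↑Λ') (y : PolySite Λ') (s : Fin 2) :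
    fermionEmbed (PolySite.toTorusEmb L hT) (clusterDiagKinetic Λ' y s) =
      if ofLex y.1 + diagVec s ∈ Λ' then torusDiagBondKinetic (Torus.proj L (ofLex y.1)) s else 0 := by
  unfold clusterDiagKinetic
  by_cases h : ofLex y.1 + diagVec s ∈ Λ'
  · rw [dif_pos h, if_pos h, fermionEmbed_sum, torusDiagBondKinetic]
    refine Finset.sum_congr rfl fun σ _ => ?_
    rw [fermionEmbed_add, fermionEmbed_mul, fermionEmbed_mul, fermionEmbed_creation,
      fermionEmbed_annihilation, fermionEmbed_creation, fermionEmbed_annihilation,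
      PolySite.toTorusEmb_apply, PolySite.toTorusEmb_apply, PolySite.ofLex_coe_pt, proj_add_site',
      proj_diagVec]
  · rw [dif_neg h, if_neg h, fermionEmbed_zero]

/-- Summing a translate over all translations forgets the base point. [cite: BratteliRobinsonII1997, §6.2.4] -/
private theorem sum_add_left_eq' {M : Type*} [AddCommMonoid M] (w : TorusSite 2 L) (F : TorusSite 2 L → M) :
    ∑ v : TorusSite 2 L, F (w + v) = ∑ v : TorusSite 2 L, F v :=
  Fintype.sum_equiv (Equiv.addLeft w) _ _ fun _ => rfl

/-- **The translates of the weighted diagonal cluster term**: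
`Σ_v T_v Γ(ι)(clusterDiagTerm) T_v⁻¹ = −t' Σ_s (Σ_x J̃'(x,s)) Σ_w K^{diag}_{w,s}` (every diagonal torus bond of type
`s` is covered with total weight `diagBondWeightSum Λ' J' s`). [cite: Anderson1951, eq. (2)] -/
theorem sum_relabel_translate_clusterDiagTerm {Λ' : Finset (Site 2)}
    (hT : Set.InjOn (Torus.proj (d := 2) L) ↑Λ') (t' : ℝ) (J' : Site 2 → Fin 2 → ℝ) :
    ∑ v : TorusSite 2 L, relabel (Orb.translate v) (fermionEmbed (PolySite.toTorusEmb L hT) (clusterDiagTerm Λ' t' J')) =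
      -(t' : ℂ) • ∑ s : Fin 2, ((diagBondWeightSum Λ' J' s : ℝ) : ℂ) • ∑ w : TorusSite 2 L, torusDiagBondKinetic w s := by
  set p : PolySite Λ' → TorusSite 2 L := fun y => Torus.proj L (ofLex y.1) with hp
  have h1 : ∀ v : TorusSite 2 L, relabel (Orb.translate v)
      (fermionEmbed (PolySite.toTorusEmb L hT) (clusterDiagTerm Λ' t' J')) =
      -(t' : ℂ) • ∑ y : PolySite Λ', ∑ s : Fin 2,
        ((diagBondWeight Λ' J' (ofLex y.1) s : ℝ) : ℂ) • torusDiagBondKinetic (p y + v) s := by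
    intro v
    rw [clusterDiagTerm, fermionEmbed_smul, fermionEmbed_sum, relabel_smul, relabel_sum]
    congr 1
    refine Finset.sum_congr rfl fun y _ => ?_
    rw [fermionEmbed_sum, relabel_sum]
    refine Finset.sum_congr rfl fun s _ => ?_
    rw [fermionEmbed_smul, relabel_smul, fermionEmbed_toTorusEmb_clusterDiagKinetic hT y s, diagBondWeight]
    by_cases h : ofLex y.1 + diagVec s ∈ Λ'
    · rw [if_pos h, if_pos h, relabel_translate_torusDiagBondKinetic]
    · rw [if_neg h, if_neg h, map_zero, smul_zero, Complex.ofReal_zero, zero_smul]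
  simp_rw [h1]
  rw [← Finset.smul_sum]
  congr 1
  rw [Finset.sum_comm]
  have hy : ∀ y : PolySite Λ', ∑ v : TorusSite 2 L, ∑ s : Fin 2,
      ((diagBondWeight Λ' J' (ofLex y.1) s : ℝ) : ℂ) • torusDiagBondKinetic (p y + v) s =
      ∑ s : Fin 2, ((diagBondWeight Λ' J' (ofLex y.1) s : ℝ) : ℂ) • ∑ w : TorusSite 2 L, torusDiagBondKinetic w s := by
    intro y
    rw [Finset.sum_comm]
    refine Finset.sum_congr rfl fun s _ => ?_
    rw [← Finset.smul_sum, sum_add_left_eq' (p y) (fun w => torusDiagBondKinetic w s)]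
  simp_rw [hy]
  rw [Finset.sum_comm]
  refine Finset.sum_congr rfl fun s _ => ?_
  rw [← Finset.sum_smul, diagBondWeightSum, ← PolySite.sum_ofLex_eq' Λ' (fun x => diagBondWeight Λ' J' x s),
    Complex.ofReal_sum]

/-! ### §3. The `t–t'` weighted cluster and the energy identity -/

/-- **The `t–t'` weighted open cluster** of the window `Λ'`: nearest-neighbour bond weights `J`, diagonal bond
weights `J'`, interaction weights `V`, potentials `μ'`:
`h = −t Σ J K + U Σ V n↑n↓ + Σ μ' n − t' Σ J' K^{diag}`. [cite: XuEtAl2024, eq. (1)] [cite: Anderson1951, eq. (2)] -/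
def clusterHamiltonianTT' (Λ' : Finset (Site 2)) (t t' U : ℝ) (J : Site 2 → Fin 2 → ℝ)
    (J' : Site 2 → Fin 2 → ℝ) (V μ' : Site 2 → ℝ) : FermionOp Λ' :=
  clusterHamiltonian Λ' t U J V μ' + clusterDiagTerm Λ' t' J'

/-- The `t–t'` weighted cluster is Hermitian. [cite: XuEtAl2024, eq. (1)] -/
theorem isHermitian_clusterHamiltonianTT' (Λ' : Finset (Site 2)) (t t' U : ℝ) (J J' : Site 2 → Fin 2 → ℝ)
    (V μ' : Site 2 → ℝ) : (clusterHamiltonianTT' Λ' t t' U J J' V μ').IsHermitian :=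
  (isHermitian_clusterHamiltonian Λ' t U J V μ').add (isHermitian_clusterDiagTerm Λ' t' J')

/-- **The translates of a NORMALISED `t–t'` weighted cluster sum to `H^{tt'}_L − μ N_L`** (`L ≥ 3`;
`Σ_x J̃(x,i) = 1` for both lattice directions, `Σ_x J̃'(x,s) = 1` for both diagonal types, `Σ V = 1`,
`Σ μ' = −μ`). [cite: XuEtAl2024, eq. (1)] [cite: Anderson1951, eq. (2)] -/
theorem sum_relabel_translate_clusterHamiltonianTT'_eq (hL : 3 ≤ L) {Λ : Finset (Site 2)}
    (hT : Set.InjOn (Torus.proj (d := 2) L) ↑Λ) (t t' U μ : ℝ) {J J' : Site 2 → Fin 2 → ℝ} {V μ' : Site 2 → ℝ}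
    (hJ : ∀ i, bondWeightSum Λ J i = 1) (hJ' : ∀ s, diagBondWeightSum Λ J' s = 1) (hV : siteWeightSum Λ V = 1)
    (hμ : siteWeightSum Λ μ' = -μ) :
    ∑ v : TorusSite 2 L, relabel (Orb.translate v)
        (fermionEmbed (PolySite.toTorusEmb L hT) (clusterHamiltonianTT' Λ t t' U J J' V μ')) =
      hubbardTorusTT' L t t' U - (μ : ℂ) • totalNumber := by
  have h1 : ∑ v : TorusSite 2 L, relabel (Orb.translate v)
      (fermionEmbed (PolySite.toTorusEmb L hT) (clusterHamiltonianTT' Λ t t' U J J' V μ')) =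
      (∑ v : TorusSite 2 L, relabel (Orb.translate v)
        (fermionEmbed (PolySite.toTorusEmb L hT) (clusterHamiltonian Λ t U J V μ'))) +
      ∑ v : TorusSite 2 L, relabel (Orb.translate v)
        (fermionEmbed (PolySite.toTorusEmb L hT) (clusterDiagTerm Λ t' J')) := by
    rw [← Finset.sum_add_distrib]
    refine Finset.sum_congr rfl fun v _ => ?_
    rw [clusterHamiltonianTT', fermionEmbed_add, relabel_add]
  rw [h1, sum_relabel_translate_clusterHamiltonian_eq_hubbardTorusWith hL hT t U μ hJ hV hμ,
    sum_relabel_translate_clusterDiagTerm hT t' J', hubbardTorusTT', hubbardTorusWith, hamiltonianWith_eq,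
    diagHamiltonian_eq_kinetic_bond_sum t' hL, ← hubbardTorus]
  simp_rw [hJ']
  simp only [Complex.ofReal_one, one_smul]
  abel

/-- **The energy identity for a `t–t'` weighted cluster.** For `L ≥ 3`, a translation-invariant torus state
`ρ`, a window `Λ` fitting into the torus and normalised weights:
`tr(ρ (H^{tt'}_L − μ N_L)) = L² · tr(ρ_Λ · h)`, `h = clusterHamiltonianTT' Λ t t' U J J' V μ'` — windows as small
as a `2 × 2` corner block qualify. [cite: BratteliRobinsonII1997, §6.2.4] [cite: XuEtAl2024, eq. (1)] -/
theorem trace_mul_hubbardTorusTT'_sub_eq_cluster (hL : 3 ≤ L) (t t' U μ : ℝ)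
    {ρ : Matrix (Finset (Orb (FermionTorus 2 L))) (Finset (Orb (FermionTorus 2 L))) ℂ}
    (hTI : ∀ w : TorusSite 2 L, relabel (Orb.translate w) ρ = ρ)
    {Λ : Finset (Site 2)} (hT : Set.InjOn (Torus.proj (d := 2) L) ↑Λ)
    {J J' : Site 2 → Fin 2 → ℝ} {V μ' : Site 2 → ℝ}
    (hJ : ∀ i, bondWeightSum Λ J i = 1) (hJ' : ∀ s, diagBondWeightSum Λ J' s = 1) (hV : siteWeightSum Λ V = 1)
    (hμ : siteWeightSum Λ μ' = -μ) :
    (ρ * (hubbardTorusTT' L t t' U - (μ : ℂ) • totalNumber)).trace =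
      ((L : ℂ) ^ 2) * (fermionPartialTrace (PolySite.toTorusEmb L hT) ρ * clusterHamiltonianTT' Λ t t' U J J' V μ').trace := by
  rw [← sum_relabel_translate_clusterHamiltonianTT'_eq hL hT t t' U μ hJ hJ' hV hμ,
    torus_trace_mul_sum_relabel_translate hTI, Matrix.trace_mul_comm ρ, ← trace_mul_fermionPartialTrace,
    Matrix.trace_mul_comm]

end Cluster

/-! ### §4. Corner weights for the diagonal bonds; the `t–t'` corner representative -/

section Corner

/-- **Corner diagonal bond weights**: the two diagonal bonds of the `2 × 2` corner block with corner `a` —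
type `0`: `(a − e₀ − e₁, a)`; type `1`: `(a − e₀, a − e₁)` — carry weight `1`, all others `0`.
[cite: XuEtAl2024, eq. (1)] -/
def cornerDiagBondWeight (a : Site 2) : Site 2 → Fin 2 → ℝ :=
  fun x s => if x + diagVec s = (if s = 0 then a else a - unitVec 1) then 1 else 0

/-- The corner diagonal weights are normalised for each type `s` as soon as the `2 × 2` corner block
`{a, a − e₀, a − e₁, a − e₀ − e₁}` lies in the window. [cite: XuEtAl2024, eq. (1)] -/
theorem diagBondWeightSum_cornerDiagBondWeight {Λ : Finset (Site 2)} {a : Site 2} (ha : a ∈ Λ)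
    (h0 : a - unitVec 0 ∈ Λ) (h1 : a - unitVec 1 ∈ Λ) (h01 : a - unitVec 0 - unitVec 1 ∈ Λ) (s : Fin 2) :
    diagBondWeightSum Λ (cornerDiagBondWeight a) s = 1 := by
  unfold diagBondWeightSum diagBondWeight cornerDiagBondWeight
  have hdv : ∀ s : Fin 2, (diagVec s : Site 2) = unitVec 0 + (if s = 0 then unitVec 1 else -unitVec 1) := by
    intro s
    funext i
    fin_cases s <;> fin_cases i <;> simp [diagVec, unitVec]
  -- the target site of the type-`s` corner bond and its (unique) source `x0`
  obtain ⟨target, x0, htarget, hx0, htmem, hx0mem⟩ : ∃ target x0 : Site 2,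
      (if s = 0 then a else a - unitVec 1) = target ∧ x0 + diagVec s = target ∧ target ∈ Λ ∧ x0 ∈ Λ := by
    have hs : s = 0 ∨ s = 1 := by fin_cases s <;> simp
    rcases hs with rfl | rfl
    · refine ⟨a, a - unitVec 0 - unitVec 1, by simp, ?_, ha, h01⟩
      rw [hdv 0, if_pos rfl]
      abel
    · refine ⟨a - unitVec 1, a - unitVec 0, by simp, ?_, h1, h0⟩
      rw [hdv 1, if_neg (by decide)]
      abel
  simp_rw [htarget]
  rw [Finset.sum_eq_single x0]
  · rw [hx0, if_pos htmem, if_pos rfl]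
  · intro x _ hne
    have hx : x + diagVec s ≠ target := fun h => hne (add_right_cancel (h.trans hx0.symm))
    by_cases hm : x + diagVec s ∈ Λ
    · rw [if_pos hm, if_neg hx]
    · rw [if_neg hm]
  · exact fun h => absurd hx0mem h

/-- **The `t–t'` corner energy representative** of the window `Λ` with corner `a`:
`h_μ = U n_{a↑}n_{a↓} − μ n_a − t (hop(a−e₀,a) + hop(a−e₁,a)) − t' (hop(a−e₀−e₁,a) + hop(a−e₀,a−e₁))`, realised as
the `t–t'` weighted cluster with corner weights. [cite: XuEtAl2024, eq. (1)] [cite: PoulinHastings2011, eqs. (3)–(8)] -/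
def cornerEnergyRepTT' (Λ : Finset (Site 2)) (a : Site 2) (t t' U μ : ℝ) : FermionOp Λ :=
  clusterHamiltonianTT' Λ t t' U (cornerBondWeight a) (cornerDiagBondWeight a) (cornerSiteWeight a)
    (fun x => -μ * cornerSiteWeight a x)

/-- The `t–t'` corner representative is Hermitian. [cite: XuEtAl2024, eq. (1)] -/
theorem isHermitian_cornerEnergyRepTT' (Λ : Finset (Site 2)) (a : Site 2) (t t' U μ : ℝ) :
    (cornerEnergyRepTT' Λ a t t' U μ).IsHermitian :=
  isHermitian_clusterHamiltonianTT' Λ t t' U _ _ _ _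

end Corner

end Literature.MathematicalPhysics.QuantumLattice

end
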